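import Mathlib

/-!
# `QuadraticDigitPhases` (stmt-QuantumAdvantage-1391), line `Sketch` — stub `stub_peel`

The LOW branch's first step of the far-complexity split. A quadratic `P` over `(ZMod 2)^n` is
`(R, s)`-low when `P ≡ Q + Σ_{t<k} ℓ_t · ℓ'_t` on the cube, with `Q` an `s`-banded quadratic (every
monomial's variables pairwise within distance `s`), `k < R`, and `ℓ_t, ℓ'_t` linear forms. If the
`s`-banded quadratic phases `(-1)^{Q(bits N)}` are uniformly `ε'`-orthogonal to the Liouville
function for every `ε' > 0` (hypothesis `hB`), then so are the `(R, s)`-low phases.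

Proof. For bits `F S a c ∈ ZMod 2`,
`(-1)^{F + S + a c} = ((-1)^{F+S} + (-1)^{F+a+S} + (-1)^{F+c+S} - (-1)^{F+a+c+S}) / 2`
(`sign_add_mul`). Peeling the last product `ℓ_k ℓ'_k` therefore writes the correlation of
`Q + Σ_{t<k+1} ℓ_t ℓ'_t` as half the signed sum of the correlations of `Q' + Σ_{t<k} ℓ_t ℓ'_t`
for the four banded quadratics `Q' ∈ {Q, Q+ℓ_k, Q+ℓ'_k, Q+ℓ_k+ℓ'_k}` (adding a linear form keeps
total degree `≤ 2` and bandedness, `banded_add_lin`); by induction on `k` the correlation is at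
most `2^k` times the banded bound (`peel_induct`), and `2^k ≤ 2^R` is absorbed by applying `hB`
with `ε / 2^R`. The hypothesis `P.totalDegree ≤ 2` of the stub is carried, not used. Mathlib only.
-/

set_option linter.dupNamespace false -- D-0017: single-problem summit ⇒ `QuantumAdvantage.QuantumAdvantage` by design

namespace Summit.QuantumAdvantage.QuantumAdvantage.Theorems.MobiusLadderQuadraticDigitPhasesStubPeel

open Finset Filter

/-- The Walsh expansion of one product of bits: for `F S a c : ZMod 2`,
`(-1)^{F + (S + a c)} = ((-1)^{F+S} + (-1)^{F+a+S} + (-1)^{F+c+S} - (-1)^{F+a+c+S}) / 2`, with the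
phase written as `if · = 1 then -1 else 1`. [folklore] -/
theorem sign_add_mul (F S a c : ZMod 2) :
    (if F + (S + a * c) = 1 then (-1 : ℝ) else 1) =
      (1 / 2) * ((if F + S = 1 then (-1 : ℝ) else 1) + (if F + a + S = 1 then (-1 : ℝ) else 1) +
        (if F + c + S = 1 then (-1 : ℝ) else 1) - (if F + a + c + S = 1 then (-1 : ℝ) else 1)) := by
  have h01 : ∀ x : ZMod 2, x = 0 ∨ x = 1 := by decide
  have h11 : (1 : ZMod 2) + 1 = 0 := by decide
  rcases h01 F with rfl | rfl <;> rcases h01 S with rfl | rfl <;> rcases h01 a with rfl | rfl <;>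
    rcases h01 c with rfl | rfl <;> simp [h11] <;> norm_num

/-- Bookkeeping for one peeling step: if `g = (f₀ + f₁ + f₂ - f₃) / 2` pointwise on `S` and each
weighted sum `Σ_S w fⱼ` has absolute value at most `B`, then `|Σ_S w g| ≤ 2 B`. [folklore] -/
theorem abs_sum_quarter {S : Finset ℕ} {w g f₀ f₁ f₂ f₃ : ℕ → ℝ} {B : ℝ}
    (hg : ∀ N ∈ S, g N = 1 / 2 * (f₀ N + f₁ N + f₂ N - f₃ N))
    (h₀ : |∑ N ∈ S, w N * f₀ N| ≤ B) (h₁ : |∑ N ∈ S, w N * f₁ N| ≤ B)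
    (h₂ : |∑ N ∈ S, w N * f₂ N| ≤ B) (h₃ : |∑ N ∈ S, w N * f₃ N| ≤ B) :
    |∑ N ∈ S, w N * g N| ≤ 2 * B := by
  have hsum : ∑ N ∈ S, w N * g N = 1 / 2 * (∑ N ∈ S, w N * f₀ N + ∑ N ∈ S, w N * f₁ N +
      ∑ N ∈ S, w N * f₂ N - ∑ N ∈ S, w N * f₃ N) := by
    rw [← Finset.sum_add_distrib, ← Finset.sum_add_distrib, ← Finset.sum_sub_distrib,
      Finset.mul_sum]
    exact Finset.sum_congr rfl fun N hN => by rw [hg N hN]; ring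
  rw [hsum, abs_le]
  obtain ⟨h₀l, h₀u⟩ := abs_le.mp h₀
  obtain ⟨h₁l, h₁u⟩ := abs_le.mp h₁
  obtain ⟨h₂l, h₂u⟩ := abs_le.mp h₂
  obtain ⟨h₃l, h₃u⟩ := abs_le.mp h₃
  constructor <;> linarith

/-- Adding a linear form `Σ_i c_i X_i` to an `s`-banded quadratic `Q` keeps total degree `≤ 2`,
keeps `s`-bandedness (the new monomials are single variables, `Nat.dist i i = 0`), and adds
`Σ_i c_i x_i` to every evaluation. [folklore] -/
theorem banded_add_lin {n : ℕ} (s : ℕ) (Q : MvPolynomial (Fin n) (ZMod 2))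
    (hQ : Q.totalDegree ≤ 2)
    (hQb : ∀ m ∈ Q.support, ∀ i ∈ m.support, ∀ j ∈ m.support, Nat.dist i j ≤ s)
    (c : Fin n → ZMod 2) :
    (Q + ∑ i, MvPolynomial.C (c i) * MvPolynomial.X i).totalDegree ≤ 2 ∧
    (∀ m ∈ (Q + ∑ i, MvPolynomial.C (c i) * MvPolynomial.X i).support,
      ∀ i ∈ m.support, ∀ j ∈ m.support, Nat.dist i j ≤ s) ∧
    ∀ x : Fin n → ZMod 2, MvPolynomial.eval x (Q + ∑ i, MvPolynomial.C (c i) * MvPolynomial.X i) =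
      MvPolynomial.eval x Q + ∑ i, c i * x i := by
  refine ⟨?_, ?_, ?_⟩
  · refine (MvPolynomial.totalDegree_add _ _).trans (max_le hQ ?_)
    refine MvPolynomial.totalDegree_finsetSum_le fun i _ => ?_
    refine (MvPolynomial.totalDegree_mul _ _).trans ?_
    simp
  · intro m hm i hi j hj
    rcases Finset.mem_union.mp (MvPolynomial.support_add hm) with hmQ | hmL
    · exact hQb m hmQ i hi j hj
    · obtain ⟨i₀, -, hi₀⟩ := Finset.mem_biUnion.mp (MvPolynomial.support_sum hmL)
      rw [MvPolynomial.C_mul_X_eq_monomial] at hi₀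
      have hm₀ : m = Finsupp.single i₀ 1 :=
        Finset.mem_singleton.mp (MvPolynomial.support_monomial_subset hi₀)
      subst hm₀
      have hi' : i = i₀ := Finset.mem_singleton.mp (Finsupp.support_single_subset hi)
      have hj' : j = i₀ := Finset.mem_singleton.mp (Finsupp.support_single_subset hj)
      subst hi' hj'
      simp [Nat.dist_self]
  · intro x
    simp [map_sum, MvPolynomial.eval_C, MvPolynomial.eval_X]

/-- The peeling induction: if every `s`-banded quadratic phase has weighted sum at most `B`
(against arbitrary weights `w` on a finite set `S`, at arbitrary points `b N`), then the phase of
`Q + Σ_{t<k} ℓ_t ℓ'_t` (`Q` banded, `ℓ_t, ℓ'_t` linear) has weighted sum at most `2^k B`.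
[folklore] -/
theorem peel_induct {n : ℕ} (s : ℕ) (B : ℝ) (S : Finset ℕ) (w : ℕ → ℝ) (b : ℕ → Fin n → ZMod 2)
    (hn : ∀ Q : MvPolynomial (Fin n) (ZMod 2), Q.totalDegree ≤ 2 →
      (∀ m ∈ Q.support, ∀ i ∈ m.support, ∀ j ∈ m.support, Nat.dist i j ≤ s) →
      |∑ N ∈ S, w N * (if MvPolynomial.eval (b N) Q = 1 then (-1 : ℝ) else 1)| ≤ B)
    (k : ℕ) :
    ∀ Q : MvPolynomial (Fin n) (ZMod 2), Q.totalDegree ≤ 2 →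
      (∀ m ∈ Q.support, ∀ i ∈ m.support, ∀ j ∈ m.support, Nat.dist i j ≤ s) →
      ∀ u v : Fin k → Fin n → ZMod 2,
      |∑ N ∈ S, w N * (if MvPolynomial.eval (b N) Q +
          ∑ t : Fin k, (∑ i : Fin n, u t i * b N i) * (∑ i : Fin n, v t i * b N i) = 1
          then (-1 : ℝ) else 1)| ≤ 2 ^ k * B := by
  induction k with
  | zero =>
    intro Q hQ hQb u v
    simp only [Finset.univ_eq_empty, Finset.sum_empty, add_zero, pow_zero, one_mul]
    exact hn Q hQ hQb
  | succ k ih =>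
    intro Q hQ hQb u v
    -- the four banded quadratics `Q`, `Q + ℓ_k`, `Q + ℓ'_k`, `Q + ℓ_k + ℓ'_k`
    obtain ⟨hQu, hQub, hQue⟩ := banded_add_lin s Q hQ hQb (u (Fin.last k))
    obtain ⟨hQv, hQvb, hQve⟩ := banded_add_lin s Q hQ hQb (v (Fin.last k))
    obtain ⟨hQuv, hQuvb, hQuve⟩ :=
      banded_add_lin s (Q + ∑ i, MvPolynomial.C (u (Fin.last k) i) * MvPolynomial.X i) hQu hQub
        (v (Fin.last k))
    have h0 := ih Q hQ hQb (fun t => u (Fin.castSucc t)) (fun t => v (Fin.castSucc t))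
    have h1 := ih _ hQu hQub (fun t => u (Fin.castSucc t)) (fun t => v (Fin.castSucc t))
    have h2 := ih _ hQv hQvb (fun t => u (Fin.castSucc t)) (fun t => v (Fin.castSucc t))
    have h3 := ih _ hQuv hQuvb (fun t => u (Fin.castSucc t)) (fun t => v (Fin.castSucc t))
    simp only [hQue, hQve, hQuve] at h1 h2 h3
    refine (abs_sum_quarter (fun N _ => ?_) h0 h1 h2 h3).trans_eq (by ring)
    rw [Fin.sum_univ_castSucc, sign_add_mul]

/-- **Stub `stub_peel`** (line `Sketch` of crux `QuadraticDigitPhases`, stmt-QuantumAdvantage-1391):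
uniform `ε`-orthogonality of the Liouville function to the `s`-banded quadratic digital phases (for
every `ε`) implies uniform `ε`-orthogonality to every `(R, s)`-low quadratic digital phase
`P ≡ Q + Σ_{t<k} ℓ_t ℓ'_t` (`Q` `s`-banded, `k < R`). Walsh-expanding the `k` products costs a
factor `2^k ≤ 2^R`, absorbed by applying the hypothesis with `ε / 2^R`. [folklore] -/
theorem stub_peel (s R : ℕ)
    (hB : ∀ ε : ℝ, 0 < ε → ∀ᶠ n : ℕ in atTop, ∀ Q : MvPolynomial (Fin n) (ZMod 2),
      Q.totalDegree ≤ 2 →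
      (∀ m ∈ Q.support, ∀ i ∈ m.support, ∀ j ∈ m.support, Nat.dist i j ≤ s) →
      |∑ N ∈ range (2 ^ n), ((ArithmeticFunction.liouville N : ℤ) : ℝ) *
          (if MvPolynomial.eval (fun i : Fin n => if Nat.testBit N i then (1 : ZMod 2) else 0) Q = 1
            then (-1 : ℝ) else 1)| ≤ ε * (2 : ℝ) ^ n) :
    ∀ ε : ℝ, 0 < ε → ∀ᶠ n : ℕ in atTop, ∀ P : MvPolynomial (Fin n) (ZMod 2),
      P.totalDegree ≤ 2 →
      (∃ Q : MvPolynomial (Fin n) (ZMod 2), Q.totalDegree ≤ 2 ∧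
        (∀ m ∈ Q.support, ∀ i ∈ m.support, ∀ j ∈ m.support, Nat.dist i j ≤ s) ∧
        ∃ k : ℕ, k < R ∧ ∃ u v : Fin k → Fin n → ZMod 2, ∀ x : Fin n → ZMod 2,
          MvPolynomial.eval x P = MvPolynomial.eval x Q +
            ∑ t : Fin k, (∑ i : Fin n, u t i * x i) * (∑ i : Fin n, v t i * x i)) →
      |∑ N ∈ range (2 ^ n), ((ArithmeticFunction.liouville N : ℤ) : ℝ) *
          (if MvPolynomial.eval (fun i : Fin n => if Nat.testBit N i then (1 : ZMod 2) else 0) P = 1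
            then (-1 : ℝ) else 1)| ≤ ε * (2 : ℝ) ^ n := by
  intro ε hε
  have hε' : 0 < ε / 2 ^ R := by positivity
  filter_upwards [hB (ε / 2 ^ R) hε'] with n hn P _hP hlow
  obtain ⟨Q, hQ, hQb, k, hkR, u, v, hPx⟩ := hlow
  have key := peel_induct s (ε / 2 ^ R * (2 : ℝ) ^ n) (range (2 ^ n))
    (fun N => ((ArithmeticFunction.liouville N : ℤ) : ℝ))
    (fun N => fun i : Fin n => if Nat.testBit N i then (1 : ZMod 2) else 0) hn k Q hQ hQb u v
  simp only [hPx]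
  refine key.trans ?_
  calc (2 : ℝ) ^ k * (ε / 2 ^ R * 2 ^ n) ≤ 2 ^ R * (ε / 2 ^ R * 2 ^ n) :=
        mul_le_mul_of_nonneg_right (pow_le_pow_right₀ (by norm_num) hkR.le) (by positivity)
    _ = ε * 2 ^ n := by field_simp

end Summit.QuantumAdvantage.QuantumAdvantage.Theorems.MobiusLadderQuadraticDigitPhasesStubPeel
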